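import Literature.Computability.Complexity.MurrayWilliams2018MachineB
import Literature.Computability.Complexity.MurrayWilliams2018EasyWitnessAssemblyQP
import HarnessLib

/-!
# Murray–Williams' headline `NQP ⊄ ACC⁰` over the polylogarithmic-seed easy witness lemma

Leaf module joining `MurrayWilliams2018MachineB.lean` — the headline
`MurrayWilliams2018_NQP_not_subset_ACC0 : ¬ (NQP ⊆ ACC0)` (`CircuitLowerBounds.lean`; C. D. Murray,
R. R. Williams, *Circuit lower bounds for nondeterministic quasi-polytime: an easy witness lemma
for NP and NQP*, STOC 2018, §1.1 and Thm. 1.3) from Murray–Williams' Lemma 1.3 at the tree's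
levels ALONE (`MurrayWilliams2018_NQP_not_subset_ACC0_of_EWL`: Williams' machine `B` at
subexponential witness size, Fact 3.1 and Thm. 4.1 being theorems) — with the polylogarithmic-seed
cone of `MurrayWilliams2018Lemma13QP.lean` / `MurrayWilliams2018EasyWitnessAssemblyQP.lean`, which
derives Lemma 1.3 at the tree's levels from **Lemma 4.1 in polylogarithmic-seed form**
(`MurrayWilliams2018_lemma_1_3_of_lemma_4_1_qp`; the form of Lemma 4.1 that the tree's PROVED
generator `IKW2002_thm11_tableGenerator` delivers, seed `c · m⁴` instead of Umans' `O(m)`), and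
that form from Theorem 3.1 (universal-referee form) and the polylogarithmic-seed advice
simulation (`MurrayWilliams2018_lemma_4_1_qp_of_thm_3_1_universal_of_qsimulation`).

* **`MurrayWilliams2018_NQP_not_subset_ACC0_of_lemma_4_1_qp`** — `¬ (NQP ⊆ ACC0)` from Lemma 4.1
  in polylogarithmic-seed form (hypothesis `hQ`, verbatim from `MurrayWilliams2018Lemma13QP.lean`);
* **`MurrayWilliams2018_NQP_not_subset_ACC0_of_thm_3_1_universal_of_qsimulation`** —
  `¬ (NQP ⊆ ACC0)` from Theorem 3.1 in universal-referee form with general `s₁, s₂` (`h31`) and the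
  polylogarithmic-seed simulation (`hsimQ`), both verbatim from
  `MurrayWilliams2018EasyWitnessAssemblyQP.lean`.

So the headline no longer needs the exponential-level simulation `hN` of
`MurrayWilliams2018ExpLevel.lean` (which the stronger Thm. 1.2 / Thm. 1.3 facts still use,
`MurrayWilliams2018_thm_1_2_acc_of_thm_3_1_universal_of_qsimulation_of_expSimulation`): its trust
base is {`h31`, `hsimQ`} — equivalently the single named fact `MurrayWilliams2018_lemma_4_1_ae`
(`MurrayWilliams2018_NQP_not_subset_ACC0_of_lemma_4_1_ae`, `MurrayWilliams2018MachineB.lean`;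
`lemma_4_1_qp_of_lemma_4_1_ae`).

Theorems only; no definition and no named fact is introduced.

## References

* C. D. Murray, R. R. Williams, *Circuit lower bounds for nondeterministic quasi-polytime: an easy
  witness lemma for NP and NQP*, STOC 2018, 890–901, §1.1, Lemma 1.3, Thm. 1.3, Thm. 3.1,
  Lemma 4.1 and its proof (§4), §5 [MurrayWilliams2018].
* R. Impagliazzo, V. Kabanets, A. Wigderson, *In search of an easy witness: exponential time vs.
  probabilistic polynomial time*, JCSS 65 (2002) 672–694, Thm. 11 [ImpagliazzoKabanetsWigderson2002].
* R. Williams, *Nonuniform ACC circuit lower bounds*, J. ACM 61 (2014), proof of Thm. 3.2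
  (machine `B`), Fact 3.1, Thm. 4.1 [Williams2014].
-/

namespace Literature.Computability.Complexity

open Filter AMPlayer

/-- **`NQP ⊄ ACC⁰` from Lemma 4.1 in polylogarithmic-seed form** (hypothesis `hQ` of
`MurrayWilliams2018Lemma13QP.lean`, verbatim): Lemma 1.3 at the tree's levels by
`MurrayWilliams2018_lemma_1_3_of_lemma_4_1_qp`, then `MurrayWilliams2018_NQP_not_subset_ACC0_of_EWL`
(machine `B` at subexponential witness size, Fact 3.1, Thm. 4.1 — all theorems).
[cite: MurrayWilliams2018, §1.1, Lemma 1.3, Lemma 4.1 and Thm. 1.3] -/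
theorem MurrayWilliams2018_NQP_not_subset_ACC0_of_lemma_4_1_qp
    (hQ : ∃ e g d C : ℕ, 1 ≤ e ∧ 1 ≤ g ∧ 1 ≤ d ∧ 1 ≤ C ∧
      ∀ (s t T : ℕ → ℕ), StrictMono s → IsTimeConstructible s → IsTimeConstructible t →
        Monotone t → IsTimeConstructible T → Monotone T →
        (∀ᶠ n in atTop, n * s n < 2 ^ (n / e)) →
        (∀ᶠ n in atTop, ((stretch s e)^[3] n) ^ d ≤ t n) →
        (∀ᶠ n in atTop, 2 ^ (C * (Nat.log 2 (t n) + 2) ^ C) ≤ T n) →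
        (∀ L ∈ NTIME T, ∀ᶠ n in atTop, L.circuitSize n ≤ s n) →
          NTIMEHasWitnessCircuits t (fun n => ((stretch s e)^[3] n) ^ (2 * g))) :
    MurrayWilliams2018_NQP_not_subset_ACC0 :=
  MurrayWilliams2018_NQP_not_subset_ACC0_of_EWL (MurrayWilliams2018_lemma_1_3_of_lemma_4_1_qp hQ)

/-- **`NQP ⊄ ACC⁰` from Theorem 3.1 (universal-referee form, general `s₁, s₂`) and the
polylogarithmic-seed advice simulation** (hypotheses `h31`, `hsimQ` of
`MurrayWilliams2018_lemma_4_1_qp_of_thm_3_1_universal_of_qsimulation`, verbatim): Lemma 4.1 in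
polylogarithmic-seed form from them, then `MurrayWilliams2018_NQP_not_subset_ACC0_of_lemma_4_1_qp`.
The exponential-level simulation `hN` of `MurrayWilliams2018ExpLevel.lean` is NOT needed for the
headline. [cite: MurrayWilliams2018, Thm. 3.1, Lemma 4.1 (proof, §4), §5 and Thm. 1.3] -/
theorem MurrayWilliams2018_NQP_not_subset_ACC0_of_thm_3_1_universal_of_qsimulation
    (h31 : ∃ Ref : Language Bool, Ref ∈ Classes.P ∧ ∃ D : ℕ, 1 ≤ D ∧
      ∀ (s s₁ s₂ : ℕ → ℕ), StrictMono s → IsTimeConstructible s →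
        (∀ᶠ n in atTop, n * s n ^ 2 < 2 ^ n) →
        IsTimeConstructible s₁ → IsTimeConstructible s₂ →
        (∀ᶠ n in atTop, (n + s n + 2) ^ D ≤ s₂ n) → (∀ᶠ n in atTop, s (s₂ n) ^ D ≤ s₁ n) →
        (∀ᶠ n in atTop, (n + s n + 2) ^ D ≤ s₁ n) →
        ∃ (adv : ℕ → List Bool) (L₁ : Language Bool),
          (∀ n, (adv n).length ≤ D * (Nat.log 2 (s₂ n) + 1)) ∧
          AdvisedMAGame Ref (fun n => (s₁ n * s₂ n) ^ D) adv L₁ ∧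
          ∀ᶠ n in atTop, s n < L₁.circuitSize n ∨ s (s₂ n) < L₁.circuitSize (s₂ n))
    (hsimQ : ∀ Ref : Language Bool, Ref ∈ Classes.P → ∃ k c₀ : ℕ, 1 ≤ k ∧
      ∀ (t m : ℕ → ℕ) (a : ℕ), IsTimeConstructible t → Monotone t → IsTimeConstructible m →
        (∀ᶠ n in atTop, m n ≤ t n) →
        ∀ {L : Language Bool} (V : NVerifier t L) (w : ℕ → ℕ) (adv : ℕ → List Bool)
          (L₁ : Language Bool),
          (∀ᶠ n in atTop, (adv n).length ≤ a * n) → AdvisedMAGame Ref m adv L₁ →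
          ∃ N' : Language Bool,
            (∀ T : ℕ → ℕ, (∀ᶠ n in atTop, 2 ^ (k * (Nat.log 2 (t n) + 2) ^ k) ≤ T n) →
              N' ∈ NTIME T) ∧
            ∀ᶠ n in atTop, ∀ xh : List Bool, xh ∈ L → xh.length = n →
              (∀ y : List Bool, y.length ≤ V.c * t xh.length + V.c → V.rel xh y = true →
                w xh.length < stringCC y) →
              ∀ ℓ : ℕ, n ≤ ℓ → (ℓ + m ℓ) ^ k ≤ w n → DecidesOnWithAdvice N' (c₀ * (a + 1)) L₁ ℓ) :
    MurrayWilliams2018_NQP_not_subset_ACC0 :=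
  MurrayWilliams2018_NQP_not_subset_ACC0_of_lemma_4_1_qp
    (MurrayWilliams2018_lemma_4_1_qp_of_thm_3_1_universal_of_qsimulation h31 hsimQ)

end Literature.Computability.Complexity
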